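import Literature.NumberTheory.Rogawski1990.RankOneUnstableTransferNonsplitCoreFold     -- ★ p843587 F0P3a-p03 (g12): THE FOLD `rankOneUnstable_core_of_signedWindow` (place-agnostic)
import HarnessLib

/-!
# R1LL-WILD (γ) — the by-hypothesis END layer «OF A SHELL WINDOW»: the ramified rank-one core from the Labesse–Langlands shell law `O(t) − O(ẽt) = κ(β)·q^{ord β}·W`,
# a locally constant window sum `W`, a locally constant bookkeeping factor, and the raw `Δ`-law (road W′ = «R1LL-WILD», architect A-p16 (g28) RULINGS A-32∕A-34∕A-37)

Topic `NumberTheory/Rogawski1990`; namespace `Literature.NumberTheory.Rogawski1990`.  THEOREMS ONLY (no definition, no instance, no notation, no named fact, no `sorry`).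
Cell `pub/hodgecm-mathlib`, crux H413 = `stmt-HodgeConjecture-24833`, line «N6nsGerm», residue «R1-CM-ram-wild» (★ def p843764); END-WILD owner ∕ assembler F0P3a-p04 (g14)
(LEAD T9-25 (b)); this is the (γ) layer of RULING A-34∕A-37 = the wild sibling of ★ p843850 `rankOneUnstable_core_of_signedPairs` — NO pairs, NO residue bits, NO `s₀`, NO pieces.
HONEST LABEL: HC_CM is proved only modulo the printed citations (2 remaining named inputs hLiu418, h413) until rung 0 closes; this layer is hypothesis-driven on the four
sockets (Ψ1∘Ψ2 = `hO`, Ψ3 = `hW`, Ψ4 = `hbook`∕`hbookU` and `hΔ`∕`hE`).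

THE SHAPE (display of record = (W′0) analytic half §D, A-p12 (g19) b7a6e0b9; Labesse 2024 Prop. 0.0.11–Th. 0.0.12; LL79 (2.1)–(2.2)).  Datum as in the fold
(`hv w μ ν f hf t₀ P d ht₀ hP hd1`, partner `e hest`), `U = {t | (↑t).1 regular}`, depth `N t := (−log v_w((τ₀ t − τ₁ t)_w)).toNat`, `Δ(t) := μ_v(a_t)⁻¹·√∏‖a_t‖`.
Abstract window data, ALL functions on `Z(t₀)`: a sign `ε` with `ε² = 1` on `U` (hands: `((hilbertSymbol L⁺_v (b₀ t) θ : ℤ) : ℂ)` of ★ R-4 p843425), `q ≠ 0` (hands: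
`Nat.card (𝓞 L⁺ ⧸ v)`), and
* **`hO` (socket Ψ1∘Ψ2∘(W′3), law B6)**: `∀ t ∈ U, m₀ ≤ N t → O_ν(↑t,f) − O_ν(e ↑t,f) = κβ t * q ^ (oβ t) * W t` — the shell unfolding of both orbital integrals on ROAD W's tree
  (★ (W′2)∕(Ψ1) B-p14 (g33)), the deep shells cancelled (★ (Ψ2) p844005 A-p12 (g19)), the surviving window read at the shell normal forms (★ (W′3) p843859∕p843959 p08 (g15));
  `κβ t` = `κ(β(t))`, `oβ t = ord_v β(t)`, `W t` = `2c_ν·W_s(t)` of the display;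
* **`hW` (socket Ψ3)**: `W` is eventually equal to `W s` at every singular `s` along `U` (★-to-be B-p04 (g35));
* **`hbook`, `hbookU` (socket Ψ4, bookkeeping)**: a function `book` eventually equal to `book s` at every singular `s` along `U`, and equal on the deep regular locus to
  `ε t * κβ t * q ^ (oβ t) * (q ^ ((N t − 1) ∕ 2))⁻¹` (display: `book = (r_η,θ)_v·(2 + β u, θ)_v·q^{−⌊(δ−1)∕2⌋}`, B-p12 (g30) (W′5′-ALG) ★ + A-p03 (g26) (W′5′-LC));
* **`hΔ`, `hE` (socket Ψ4, `Δ`-side)**: VERBATIM the fold's binders (★ R-4 p843425 raw with `εD := (b₀ t, θ)_v`, `E t := μ_v(a_t)⁻¹·C⁻¹·q^{⌊(N t−1)∕2⌋}·√∏‖a_t‖`, A-32∕A-37).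
OUTPUT: the core conclusion at this datum (★ p843033's `hcore` shape), by ★ `rankOneUnstable_core_of_signedWindow` with `b := q`, `m := m₀`, `Ψ t := book t * W t`:
`hD` is then the ALGEBRA `ε·q^k·(ε·κβ·q^o·q^{−k}·W) = κβ·q^o·W` (`ε² = 1`), and `hΨ` is the product of two eventually-constant functions.
NOT here: the dischargers (the END-WILD HEAD `rankOneUnstable_core_ramified_wild`, this seat, after Ψ1–Ψ4 land) and the closer ★ p843935 (F0P3-p02 (g13)).

## References
* [Rogawski1990] J. D. Rogawski, *Automorphic Representations of Unitary Groups in Three Variables* (1990): §4.9 Lemma 4.9.3, (4.9.2) p. 56.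
* [LabesseLanglands1979] J.-P. Labesse, R. P. Langlands, *L-indistinguishability for SL(2)*, Canad. J. Math. 31 (1979): §2, (2.1)–(2.2) pp. 8–10.
-/

set_option autoImplicit false

noncomputable section

open Set Filter Topology MeasureTheory NumberField IsDedekindDomain
open scoped Matrix MatrixGroups

namespace Literature.NumberTheory.Rogawski1990

open Literature.NumberTheory.Automorphic Literature.NumberTheory.Automorphic.UnitaryGroup Literature.NumberTheory.GaloisRepresentations

section OfShellWindow

variable (L : Type) [Field L] [NumberField L] [IsCMField L] (v : HeightOneSpectrum (𝓞 ↥(maximalRealSubfield L)))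

-- `L_w`-sized statement: elaboration budget only (no search)
set_option maxHeartbeats 1600000 in
/-- **(R1-core) FROM A SHELL WINDOW — THE WILD (γ) LAYER** (see the module docstring for the reading of each binder; `U = {t | (↑t).1 regular}`, `N t` the road's depth).
Feeds ★ `rankOneUnstable_core_of_signedWindow` with `b := q`, `m := m₀`, `Ψ := book · W`. [cite: Rogawski1990, §4.9 Lemma 4.9.3 (4.9.2) p. 56] [cite: LabesseLanglands1979, §2 (2.1)–(2.2)] -/
theorem rankOneUnstable_core_of_shellWindow (hv : Subsingleton (PlacesOver L v)) (w : PlacesOver L v) (μ : HeckeCharacter L)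
    [MeasurableSpace ((cmDatum L 2 (Matrix.of fun i j : Fin 2 => if i.val + j.val + 1 = 2 then (1 : L) else 0)).Local v × (cmDatum L 1 (Matrix.of fun i j : Fin 1 => if i.val + j.val + 1 = 1 then (1 : L) else 0)).Local v)] [BorelSpace ((cmDatum L 2 (Matrix.of fun i j : Fin 2 => if i.val + j.val + 1 = 2 then (1 : L) else 0)).Local v × (cmDatum L 1 (Matrix.of fun i j : Fin 1 => if i.val + j.val + 1 = 1 then (1 : L) else 0)).Local v)] (ν : Measure ((cmDatum L 2 (Matrix.of fun i j : Fin 2 => if i.val + j.val + 1 = 2 then (1 : L) else 0)).Local v × (cmDatum L 1 (Matrix.of fun i j : Fin 1 => if i.val + j.val + 1 = 1 then (1 : L) else 0)).Local v)) [ν.IsHaarMeasure] [ν.IsMulRightInvariant]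
    (f : ((cmDatum L 2 (Matrix.of fun i j : Fin 2 => if i.val + j.val + 1 = 2 then (1 : L) else 0)).Local v × (cmDatum L 1 (Matrix.of fun i j : Fin 1 => if i.val + j.val + 1 = 1 then (1 : L) else 0)).Local v) → ℂ) (hf : IsLocSmooth f)
    (t₀ : ((cmDatum L 2 (Matrix.of fun i j : Fin 2 => if i.val + j.val + 1 = 2 then (1 : L) else 0)).Local v × (cmDatum L 1 (Matrix.of fun i j : Fin 1 => if i.val + j.val + 1 = 1 then (1 : L) else 0)).Local v)) (P : GL (Fin 2) (LocalRing L v)) (d : Fin 2 → (LocalRing L v)) (ht₀ : IsRegularElt (t₀.1.val : GL (Fin 2) (LocalRing L v)))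
    (hP : (t₀.1.val.val : Matrix (Fin 2) (Fin 2) (LocalRing L v)) * P.val = P.val * Matrix.diagonal d) (hd1 : ∀ i, conjLocal L (IsCMField.complexConj L) v (d i) * d i = 1)
    (e : ((cmDatum L 2 (Matrix.of fun i j : Fin 2 => if i.val + j.val + 1 = 2 then (1 : L) else 0)).Local v × (cmDatum L 1 (Matrix.of fun i j : Fin 1 => if i.val + j.val + 1 = 1 then (1 : L) else 0)).Local v) ≃ₜ* ((cmDatum L 2 (Matrix.of fun i j : Fin 2 => if i.val + j.val + 1 = 2 then (1 : L) else 0)).Local v × (cmDatum L 1 (Matrix.of fun i j : Fin 1 => if i.val + j.val + 1 = 1 then (1 : L) else 0)).Local v))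
    (hest : ∀ t : ↥(Subgroup.centralizer ({t₀} : Set ((cmDatum L 2 (Matrix.of fun i j : Fin 2 => if i.val + j.val + 1 = 2 then (1 : L) else 0)).Local v × (cmDatum L 1 (Matrix.of fun i j : Fin 1 => if i.val + j.val + 1 = 1 then (1 : L) else 0)).Local v))), IsRegularElt ((t : ((cmDatum L 2 (Matrix.of fun i j : Fin 2 => if i.val + j.val + 1 = 2 then (1 : L) else 0)).Local v × (cmDatum L 1 (Matrix.of fun i j : Fin 1 => if i.val + j.val + 1 = 1 then (1 : L) else 0)).Local v)).1.val : GL (Fin 2) (LocalRing L v)) → IsLocalStablyConjH L v (t : ((cmDatum L 2 (Matrix.of fun i j : Fin 2 => if i.val + j.val + 1 = 2 then (1 : L) else 0)).Local v × (cmDatum L 1 (Matrix.of fun i j : Fin 1 => if i.val + j.val + 1 = 1 then (1 : L) else 0)).Local v)) (e (t : ((cmDatum L 2 (Matrix.of fun i j : Fin 2 => if i.val + j.val + 1 = 2 then (1 : L) else 0)).Local v × (cmDatum L 1 (Matrix.of fun i j : Fin 1 => if i.val + j.val + 1 = 1 then (1 : L) else 0)).Local v))) ∧ ¬ IsConj (t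 : ((cmDatum L 2 (Matrix.of fun i j : Fin 2 => if i.val + j.val + 1 = 2 then (1 : L) else 0)).Local v × (cmDatum L 1 (Matrix.of fun i j : Fin 1 => if i.val + j.val + 1 = 1 then (1 : L) else 0)).Local v)) (e (t : ((cmDatum L 2 (Matrix.of fun i j : Fin 2 => if i.val + j.val + 1 = 2 then (1 : L) else 0)).Local v × (cmDatum L 1 (Matrix.of fun i j : Fin 1 => if i.val + j.val + 1 = 1 then (1 : L) else 0)).Local v))))
    -- the sign and the base
    (q : ℕ) (hq : (q : ℂ) ≠ 0) (ε : ↥(Subgroup.centralizer ({t₀} : Set ((cmDatum L 2 (Matrix.of fun i j : Fin 2 => if i.val + j.val + 1 = 2 then (1 : L) else 0)).Local v × (cmDatum L 1 (Matrix.of fun i j : Fin 1 => if i.val + j.val + 1 = 1 then (1 : L) else 0)).Local v))) → ℂ) (hε : ∀ t : ↥(Subgroup.centralizer ({t₀} : Set ((cmDatum L 2 (Matrix.of fun i j : Fin 2 => if i.val + j.val + 1 = 2 then (1 : L) else 0)).Local v × (cmDatum L 1 (Matrix.of fun i j : Fin 1 => if i.val + j.val + 1 = 1 then (1 : L) else 0)).Local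 v))), t ∈ {t : ↥(Subgroup.centralizer ({t₀} : Set ((cmDatum L 2 (Matrix.of fun i j : Fin 2 => if i.val + j.val + 1 = 2 then (1 : L) else 0)).Local v × (cmDatum L 1 (Matrix.of fun i j : Fin 1 => if i.val + j.val + 1 = 1 then (1 : L) else 0)).Local v))) | IsRegularElt ((t : ((cmDatum L 2 (Matrix.of fun i j : Fin 2 => if i.val + j.val + 1 = 2 then (1 : L) else 0)).Local v × (cmDatum L 1 (Matrix.of fun i j : Fin 1 => if i.val + j.val + 1 = 1 then (1 : L) else 0)).Local v)).1.val : GL (Fin 2) (LocalRing L v))} → ε t * ε t = 1)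
    -- (Ψ1∘Ψ2∘W′3) the shell law B6 on the deep regular locus
    (m₀ : ℕ) (κβ W book : ↥(Subgroup.centralizer ({t₀} : Set ((cmDatum L 2 (Matrix.of fun i j : Fin 2 => if i.val + j.val + 1 = 2 then (1 : L) else 0)).Local v × (cmDatum L 1 (Matrix.of fun i j : Fin 1 => if i.val + j.val + 1 = 1 then (1 : L) else 0)).Local v))) → ℂ) (oβ : ↥(Subgroup.centralizer ({t₀} : Set ((cmDatum L 2 (Matrix.of fun i j : Fin 2 => if i.val + j.val + 1 = 2 then (1 : L) else 0)).Local v × (cmDatum L 1 (Matrix.of fun i j : Fin 1 => if i.val + j.val + 1 = 1 then (1 : L) else 0)).Local v))) → ℕ)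
    (hO : ∀ t : ↥(Subgroup.centralizer ({t₀} : Set ((cmDatum L 2 (Matrix.of fun i j : Fin 2 => if i.val + j.val + 1 = 2 then (1 : L) else 0)).Local v × (cmDatum L 1 (Matrix.of fun i j : Fin 1 => if i.val + j.val + 1 = 1 then (1 : L) else 0)).Local v))), t ∈ {t : ↥(Subgroup.centralizer ({t₀} : Set ((cmDatum L 2 (Matrix.of fun i j : Fin 2 => if i.val + j.val + 1 = 2 then (1 : L) else 0)).Local v × (cmDatum L 1 (Matrix.of fun i j : Fin 1 => if i.val + j.val + 1 = 1 then (1 : L) else 0)).Local v))) | IsRegularElt ((t : ((cmDatum L 2 (Matrix.of fun i j : Fin 2 => if i.val + j.val + 1 = 2 then (1 : L) else 0)).Local v × (cmDatum L 1 (Matrix.of fun i j : Fin 1 => if i.val + j.val + 1 = 1 then (1 : L) else 0)).Local v)).1.val : GL (Fin 2) (LocalRing L v))} → m₀ ≤ (-WithZero.log (Valued.v ((((P⁻¹).val * ((t : ((cmDatum L 2 (Matrix.of fun i j : Fin 2 => if i.val + j.val + 1 = 2 then (1 : L) else 0)).Local v × (cmDatum L 1 (Matrix.of fun i j : Fin 1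 => if i.val + j.val + 1 = 1 then (1 : L) else 0)).Local v)).1.val.val : Matrix (Fin 2) (Fin 2) (LocalRing L v)) * P.val) 0 0 - ((P⁻¹).val * ((t : ((cmDatum L 2 (Matrix.of fun i j : Fin 2 => if i.val + j.val + 1 = 2 then (1 : L) else 0)).Local v × (cmDatum L 1 (Matrix.of fun i j : Fin 1 => if i.val + j.val + 1 = 1 then (1 : L) else 0)).Local v)).1.val.val : Matrix (Fin 2) (Fin 2) (LocalRing L v)) * P.val) 1 1) w))).toNat →
      ((∫ y, f (y * (t : ((cmDatum L 2 (Matrix.of fun i j : Fin 2 => if i.val + j.val + 1 = 2 then (1 : L) else 0)).Local v × (cmDatum L 1 (Matrix.of fun i j : Fin 1 => if i.val + j.val + 1 = 1 then (1 : L) else 0)).Local v)) * y⁻¹) ∂ν) - ∫ y, f (y * e (t : ((cmDatum L 2 (Matrix.of fun i j : Fin 2 => if i.val + j.val + 1 = 2 then (1 : L) else 0)).Local v × (cmDatum L 1 (Matrix.of fun i j : Fin 1 => if i.val + j.val + 1 = 1 then (1 : L) else 0)).Local v)) * y⁻¹) ∂ν) = κβ t * (q : ℂ) ^ (oβ t)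 * W t)
    -- (Ψ3) the window sum is eventually constant at every singular point
    (hW : ∀ s : ↥(Subgroup.centralizer ({t₀} : Set ((cmDatum L 2 (Matrix.of fun i j : Fin 2 => if i.val + j.val + 1 = 2 then (1 : L) else 0)).Local v × (cmDatum L 1 (Matrix.of fun i j : Fin 1 => if i.val + j.val + 1 = 1 then (1 : L) else 0)).Local v))), ¬ IsRegularElt ((s : ((cmDatum L 2 (Matrix.of fun i j : Fin 2 => if i.val + j.val + 1 = 2 then (1 : L) else 0)).Local v × (cmDatum L 1 (Matrix.of fun i j : Fin 1 => if i.val + j.val + 1 = 1 then (1 : L) else 0)).Local v)).1.val : GL (Fin 2) (LocalRing L v)) →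
      ∀ᶠ (t : ↥(Subgroup.centralizer ({t₀} : Set ((cmDatum L 2 (Matrix.of fun i j : Fin 2 => if i.val + j.val + 1 = 2 then (1 : L) else 0)).Local v × (cmDatum L 1 (Matrix.of fun i j : Fin 1 => if i.val + j.val + 1 = 1 then (1 : L) else 0)).Local v)))) in 𝓝 s, t ∈ {t : ↥(Subgroup.centralizer ({t₀} : Set ((cmDatum L 2 (Matrix.of fun i j : Fin 2 => if i.val + j.val + 1 = 2 then (1 : L) else 0)).Local v × (cmDatum L 1 (Matrix.of fun i j : Fin 1 => if i.val + j.val + 1 = 1 then (1 : L) else 0)).Local v))) | IsRegularElt ((t : ((cmDatum L 2 (Matrix.of fun i j : Fin 2 => if i.val + j.val + 1 = 2 then (1 : L) else 0)).Local v × (cmDatum L 1 (Matrix.of fun i j : Fin 1 => if i.val + j.val + 1 = 1 then (1 : L) else 0)).Local v)).1.val : GL (Fin 2) (LocalRing L v))} → W t = W s)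
    -- (Ψ4) bookkeeping: `book` locally constant at singular points and `= ε·κβ·q^oβ·q^(−(N−1)∕2)` on the deep regular locus
    (hbook : ∀ s : ↥(Subgroup.centralizer ({t₀} : Set ((cmDatum L 2 (Matrix.of fun i j : Fin 2 => if i.val + j.val + 1 = 2 then (1 : L) else 0)).Local v × (cmDatum L 1 (Matrix.of fun i j : Fin 1 => if i.val + j.val + 1 = 1 then (1 : L) else 0)).Local v))), ¬ IsRegularElt ((s : ((cmDatum L 2 (Matrix.of fun i j : Fin 2 => if i.val + j.val + 1 = 2 then (1 : L) else 0)).Local v × (cmDatum L 1 (Matrix.of fun i j : Fin 1 => if i.val + j.val + 1 = 1 then (1 : L) else 0)).Local v)).1.val : GL (Fin 2) (LocalRing L v)) →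
      ∀ᶠ (t : ↥(Subgroup.centralizer ({t₀} : Set ((cmDatum L 2 (Matrix.of fun i j : Fin 2 => if i.val + j.val + 1 = 2 then (1 : L) else 0)).Local v × (cmDatum L 1 (Matrix.of fun i j : Fin 1 => if i.val + j.val + 1 = 1 then (1 : L) else 0)).Local v)))) in 𝓝 s, t ∈ {t : ↥(Subgroup.centralizer ({t₀} : Set ((cmDatum L 2 (Matrix.of fun i j : Fin 2 => if i.val + j.val + 1 = 2 then (1 : L) else 0)).Local v × (cmDatum L 1 (Matrix.of fun i j : Fin 1 => if i.val + j.val + 1 = 1 then (1 : L) else 0)).Local v))) | IsRegularElt ((t : ((cmDatum L 2 (Matrix.of fun i j : Fin 2 => if i.val + j.val + 1 = 2 then (1 : L) else 0)).Local v × (cmDatum L 1 (Matrix.of fun i j : Fin 1 => if i.val + j.val + 1 = 1 then (1 : L) else 0)).Local v)).1.val : GL (Fin 2) (LocalRing L v))} → book t = book s)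
    (hbookU : ∀ t : ↥(Subgroup.centralizer ({t₀} : Set ((cmDatum L 2 (Matrix.of fun i j : Fin 2 => if i.val + j.val + 1 = 2 then (1 : L) else 0)).Local v × (cmDatum L 1 (Matrix.of fun i j : Fin 1 => if i.val + j.val + 1 = 1 then (1 : L) else 0)).Local v))), t ∈ {t : ↥(Subgroup.centralizer ({t₀} : Set ((cmDatum L 2 (Matrix.of fun i j : Fin 2 => if i.val + j.val + 1 = 2 then (1 : L) else 0)).Local v × (cmDatum L 1 (Matrix.of fun i j : Fin 1 => if i.val + j.val + 1 = 1 then (1 : L) else 0)).Local v))) | IsRegularElt ((t : ((cmDatum L 2 (Matrix.of fun i j : Fin 2 => if i.val + j.val + 1 = 2 then (1 : L) else 0)).Local v × (cmDatum L 1 (Matrix.of fun i j : Fin 1 => if i.val + j.val + 1 = 1 then (1 : L) else 0)).Local v)).1.val : GL (Fin 2) (LocalRing L v))} → m₀ ≤ (-WithZero.log (Valued.v ((((P⁻¹).val * ((t : ((cmDatum L 2 (Matrix.of fun i j : Fin 2 => if i.val + j.val + 1 = 2 then (1 : L) else 0)).Local v × (cmDatum L 1 (Matrix.of fun i j : Fin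 1 => if i.val + j.val + 1 = 1 then (1 : L) else 0)).Local v)).1.val.val : Matrix (Fin 2) (Fin 2) (LocalRing L v)) * P.val) 0 0 - ((P⁻¹).val * ((t : ((cmDatum L 2 (Matrix.of fun i j : Fin 2 => if i.val + j.val + 1 = 2 then (1 : L) else 0)).Local v × (cmDatum L 1 (Matrix.of fun i j : Fin 1 => if i.val + j.val + 1 = 1 then (1 : L) else 0)).Local v)).1.val.val : Matrix (Fin 2) (Fin 2) (LocalRing L v)) * P.val) 1 1) w))).toNat →
      book t = ε t * κβ t * (q : ℂ) ^ (oβ t) * ((q : ℂ) ^ (((-WithZero.log (Valued.v ((((P⁻¹).val * ((t : ((cmDatum L 2 (Matrix.of fun i j : Fin 2 => if i.val + j.val + 1 = 2 then (1 : L) else 0)).Local v × (cmDatum L 1 (Matrix.of fun i j : Fin 1 => if i.val + j.val + 1 = 1 then (1 : L) else 0)).Local v)).1.val.val : Matrix (Fin 2) (Fin 2) (LocalRing L v)) * P.val) 0 0 - ((P⁻¹).val * ((t : ((cmDatum L 2 (Matrix.of fun i j : Fin 2 => if i.val + j.val + 1 = 2 then (1 : L) else 0)).Local v × (cmDatum L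 1 (Matrix.of fun i j : Fin 1 => if i.val + j.val + 1 = 1 then (1 : L) else 0)).Local v)).1.val.val : Matrix (Fin 2) (Fin 2) (LocalRing L v)) * P.val) 1 1) w))).toNat - 1) / 2))⁻¹)
    -- (Ψ4) the `Δ`-side: the fold's binders verbatim
    (N₁ : ℕ) (E : ↥(Subgroup.centralizer ({t₀} : Set ((cmDatum L 2 (Matrix.of fun i j : Fin 2 => if i.val + j.val + 1 = 2 then (1 : L) else 0)).Local v × (cmDatum L 1 (Matrix.of fun i j : Fin 1 => if i.val + j.val + 1 = 1 then (1 : L) else 0)).Local v))) → ℂ)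
    (hE : ∀ s : ↥(Subgroup.centralizer ({t₀} : Set ((cmDatum L 2 (Matrix.of fun i j : Fin 2 => if i.val + j.val + 1 = 2 then (1 : L) else 0)).Local v × (cmDatum L 1 (Matrix.of fun i j : Fin 1 => if i.val + j.val + 1 = 1 then (1 : L) else 0)).Local v))), ¬ IsRegularElt ((s : ((cmDatum L 2 (Matrix.of fun i j : Fin 2 => if i.val + j.val + 1 = 2 then (1 : L) else 0)).Local v × (cmDatum L 1 (Matrix.of fun i j : Fin 1 => if i.val + j.val + 1 = 1 then (1 : L) else 0)).Local v)).1.val : GL (Fin 2) (LocalRing L v)) →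
      ∀ᶠ (t : ↥(Subgroup.centralizer ({t₀} : Set ((cmDatum L 2 (Matrix.of fun i j : Fin 2 => if i.val + j.val + 1 = 2 then (1 : L) else 0)).Local v × (cmDatum L 1 (Matrix.of fun i j : Fin 1 => if i.val + j.val + 1 = 1 then (1 : L) else 0)).Local v)))) in 𝓝 s, t ∈ {t : ↥(Subgroup.centralizer ({t₀} : Set ((cmDatum L 2 (Matrix.of fun i j : Fin 2 => if i.val + j.val + 1 = 2 then (1 : L) else 0)).Local v × (cmDatum L 1 (Matrix.of fun i j : Fin 1 => if i.val + j.val + 1 = 1 then (1 : L) else 0)).Local v))) | IsRegularElt ((t : ((cmDatum L 2 (Matrix.of fun i j : Fin 2 => if i.val + j.val + 1 = 2 then (1 : L) else 0)).Local v × (cmDatum L 1 (Matrix.of fun i j : Fin 1 => if i.val + j.val + 1 = 1 then (1 : L) else 0)).Local v)).1.val : GL (Fin 2) (LocalRing L v))} → E t = E s)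
    (hΔ : ∀ t : ↥(Subgroup.centralizer ({t₀} : Set ((cmDatum L 2 (Matrix.of fun i j : Fin 2 => if i.val + j.val + 1 = 2 then (1 : L) else 0)).Local v × (cmDatum L 1 (Matrix.of fun i j : Fin 1 => if i.val + j.val + 1 = 1 then (1 : L) else 0)).Local v))), t ∈ {t : ↥(Subgroup.centralizer ({t₀} : Set ((cmDatum L 2 (Matrix.of fun i j : Fin 2 => if i.val + j.val + 1 = 2 then (1 : L) else 0)).Local v × (cmDatum L 1 (Matrix.of fun i j : Fin 1 => if i.val + j.val + 1 = 1 then (1 : L) else 0)).Local v))) | IsRegularElt ((t : ((cmDatum L 2 (Matrix.of fun i j : Fin 2 => if i.val + j.val + 1 = 2 then (1 : L) else 0)).Local v × (cmDatum L 1 (Matrix.of fun i j : Fin 1 => if i.val + j.val + 1 = 1 then (1 : L) else 0)).Local v)).1.val : GL (Fin 2) (LocalRing L v))} →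
      N₁ ≤ (-WithZero.log (Valued.v ((((P⁻¹).val * ((t : ((cmDatum L 2 (Matrix.of fun i j : Fin 2 => if i.val + j.val + 1 = 2 then (1 : L) else 0)).Local v × (cmDatum L 1 (Matrix.of fun i j : Fin 1 => if i.val + j.val + 1 = 1 then (1 : L) else 0)).Local v)).1.val.val : Matrix (Fin 2) (Fin 2) (LocalRing L v)) * P.val) 0 0 - ((P⁻¹).val * ((t : ((cmDatum L 2 (Matrix.of fun i j : Fin 2 => if i.val + j.val + 1 = 2 then (1 : L) else 0)).Local v × (cmDatum L 1 (Matrix.of fun i j : Fin 1 => if i.val + j.val + 1 = 1 then (1 : L) else 0)).Local v)).1.val.val : Matrix (Fin 2) (Fin 2) (LocalRing L v)) * P.val) 1 1) w))).toNat →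
      ((finHeckeValue L v μ (((P⁻¹).val * ((t : ((cmDatum L 2 (Matrix.of fun i j : Fin 2 => if i.val + j.val + 1 = 2 then (1 : L) else 0)).Local v × (cmDatum L 1 (Matrix.of fun i j : Fin 1 => if i.val + j.val + 1 = 1 then (1 : L) else 0)).Local v)).1.val.val : Matrix (Fin 2) (Fin 2) (LocalRing L v)) * P.val) 0 0 - ((P⁻¹).val * ((t : ((cmDatum L 2 (Matrix.of fun i j : Fin 2 => if i.val + j.val + 1 = 2 then (1 : L) else 0)).Local v × (cmDatum L 1 (Matrix.of fun i j : Fin 1 => if i.val + j.val + 1 = 1 then (1 : L) else 0)).Local v)).1.val.val : Matrix (Fin 2) (Fin 2) (LocalRing L v)) * P.val) 1 1))⁻¹ : ℂ) * ((Real.sqrt (∏ w' : PlacesOver L v, ‖(((P⁻¹).val * ((t : ((cmDatum L 2 (Matrix.of fun i j : Fin 2 => if i.val + j.val + 1 = 2 then (1 : L) else 0)).Local v × (cmDatum L 1 (Matrix.of fun i j : Fin 1 => if i.val + j.val + 1 = 1 then (1 : L) else 0)).Local v)).1.val.val : Matrix (Fin 2) (Fin 2) (LocalRing L v)) * P.val)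 0 0 - ((P⁻¹).val * ((t : ((cmDatum L 2 (Matrix.of fun i j : Fin 2 => if i.val + j.val + 1 = 2 then (1 : L) else 0)).Local v × (cmDatum L 1 (Matrix.of fun i j : Fin 1 => if i.val + j.val + 1 = 1 then (1 : L) else 0)).Local v)).1.val.val : Matrix (Fin 2) (Fin 2) (LocalRing L v)) * P.val) 1 1) w'‖) : ℝ) : ℂ) * ε t =
        E t * ((q : ℂ) ^ (((-WithZero.log (Valued.v ((((P⁻¹).val * ((t : ((cmDatum L 2 (Matrix.of fun i j : Fin 2 => if i.val + j.val + 1 = 2 then (1 : L) else 0)).Local v × (cmDatum L 1 (Matrix.of fun i j : Fin 1 => if i.val + j.val + 1 = 1 then (1 : L) else 0)).Local v)).1.val.val : Matrix (Fin 2) (Fin 2) (LocalRing L v)) * P.val) 0 0 - ((P⁻¹).val * ((t : ((cmDatum L 2 (Matrix.of fun i j : Fin 2 => if i.val + j.val + 1 = 2 then (1 : L) else 0)).Local v × (cmDatum L 1 (Matrix.of fun i j : Fin 1 => if i.val + j.val + 1 = 1 then (1 : L) else 0)).Local v)).1.val.val : Matrix (Fin 2) (Fin 2) (LocalRing L v))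 * P.val) 1 1) w))).toNat - 1) / 2))⁻¹) :
    ∃ fC : ↥(Subgroup.centralizer ({t₀} : Set ((cmDatum L 2 (Matrix.of fun i j : Fin 2 => if i.val + j.val + 1 = 2 then (1 : L) else 0)).Local v × (cmDatum L 1 (Matrix.of fun i j : Fin 1 => if i.val + j.val + 1 = 1 then (1 : L) else 0)).Local v))) → ℂ, IsLocallyConstant fC ∧
      ∀ t : ↥(Subgroup.centralizer ({t₀} : Set ((cmDatum L 2 (Matrix.of fun i j : Fin 2 => if i.val + j.val + 1 = 2 then (1 : L) else 0)).Local v × (cmDatum L 1 (Matrix.of fun i j : Fin 1 => if i.val + j.val + 1 = 1 then (1 : L) else 0)).Local v))), IsRegularElt ((t : ((cmDatum L 2 (Matrix.of fun i j : Fin 2 => if i.val + j.val + 1 = 2 then (1 : L) else 0)).Local v × (cmDatum L 1 (Matrix.of fun i j : Fin 1 => if i.val + j.val + 1 = 1 then (1 : L) else 0)).Local v)).1.val : GL (Fin 2) (LocalRing L v)) → ∀ t' : ((cmDatum L 2 (Matrix.of fun i j : Fin 2 => if i.val + j.val + 1 = 2 then (1 : L) else 0)).Local v × (cmDatum L 1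 (Matrix.of fun i j : Fin 1 => if i.val + j.val + 1 = 1 then (1 : L) else 0)).Local v),
        IsLocalStablyConjH L v (t : ((cmDatum L 2 (Matrix.of fun i j : Fin 2 => if i.val + j.val + 1 = 2 then (1 : L) else 0)).Local v × (cmDatum L 1 (Matrix.of fun i j : Fin 1 => if i.val + j.val + 1 = 1 then (1 : L) else 0)).Local v)) t' → ¬ IsConj (t : ((cmDatum L 2 (Matrix.of fun i j : Fin 2 => if i.val + j.val + 1 = 2 then (1 : L) else 0)).Local v × (cmDatum L 1 (Matrix.of fun i j : Fin 1 => if i.val + j.val + 1 = 1 then (1 : L) else 0)).Local v)) t' →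
        ((finHeckeValue L v μ (((P⁻¹).val * ((t : ((cmDatum L 2 (Matrix.of fun i j : Fin 2 => if i.val + j.val + 1 = 2 then (1 : L) else 0)).Local v × (cmDatum L 1 (Matrix.of fun i j : Fin 1 => if i.val + j.val + 1 = 1 then (1 : L) else 0)).Local v)).1.val.val : Matrix (Fin 2) (Fin 2) (LocalRing L v)) * P.val) 0 0 - ((P⁻¹).val * ((t : ((cmDatum L 2 (Matrix.of fun i j : Fin 2 => if i.val + j.val + 1 = 2 then (1 : L) else 0)).Local v × (cmDatum L 1 (Matrix.of fun i j : Fin 1 => if i.val + j.val + 1 = 1 then (1 : L) else 0)).Local v)).1.val.val : Matrix (Fin 2) (Fin 2) (LocalRing L v)) * P.val) 1 1))⁻¹ : ℂ) * ((Real.sqrt (∏ w' : PlacesOver L v, ‖(((P⁻¹).val * ((t : ((cmDatum L 2 (Matrix.of fun i j : Fin 2 => if i.val + j.val + 1 = 2 then (1 : L) else 0)).Local v × (cmDatum L 1 (Matrix.of fun i j : Fin 1 => if i.val + j.val + 1 = 1 then (1 : L) else 0)).Local v)).1.val.val : Matrix (Fin 2) (Fin 2) (LocalRing L v)) * P.val)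 0 0 - ((P⁻¹).val * ((t : ((cmDatum L 2 (Matrix.of fun i j : Fin 2 => if i.val + j.val + 1 = 2 then (1 : L) else 0)).Local v × (cmDatum L 1 (Matrix.of fun i j : Fin 1 => if i.val + j.val + 1 = 1 then (1 : L) else 0)).Local v)).1.val.val : Matrix (Fin 2) (Fin 2) (LocalRing L v)) * P.val) 1 1) w'‖) : ℝ) : ℂ) *
          ((∫ y, f (y * (t : ((cmDatum L 2 (Matrix.of fun i j : Fin 2 => if i.val + j.val + 1 = 2 then (1 : L) else 0)).Local v × (cmDatum L 1 (Matrix.of fun i j : Fin 1 => if i.val + j.val + 1 = 1 then (1 : L) else 0)).Local v)) * y⁻¹) ∂ν) - ∫ y, f (y * t' * y⁻¹) ∂ν) = fC t := by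
  refine rankOneUnstable_core_of_signedWindow L v hv w μ ν f hf t₀ P d ht₀ hP hd1 e hest m₀ N₁ E ε (fun t => book t * W t) hq hE ?_ ?_ hΔ
  · -- `hΨ`: product of two eventually-constant functions
    intro s hs
    filter_upwards [hW s hs, hbook s hs] with t htW htb htU
    rw [htW htU, htb htU]
  · -- `hD`: `ε·q^k·(book·W) = κβ·q^o·W` on the deep regular locus (`ε² = 1`)
    intro t htU hm
    rw [hO t htU hm, hbookU t htU hm]
    have hqk : ((q : ℂ) ^ (((-WithZero.log (Valued.v ((((P⁻¹).val * ((t : ((cmDatum L 2 (Matrix.of fun i j : Fin 2 => if i.val + j.val + 1 = 2 then (1 : L) else 0)).Local v × (cmDatum L 1 (Matrix.of fun i j : Fin 1 => if i.val + j.val + 1 = 1 then (1 : L) else 0)).Local v)).1.val.val : Matrix (Fin 2) (Fin 2) (LocalRing L v)) * P.val) 0 0 - ((P⁻¹).val * ((t : ((cmDatum L 2 (Matrix.of fun i j : Fin 2 => if i.val + j.val + 1 = 2 then (1 : L) else 0)).Local v × (cmDatum L 1 (Matrix.of fun i j : Fin 1 => if i.val + j.val + 1 = 1 then (1 : L) else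 0)).Local v)).1.val.val : Matrix (Fin 2) (Fin 2) (LocalRing L v)) * P.val) 1 1) w))).toNat - 1) / 2)) ≠ 0 := pow_ne_zero _ hq
    have hεε := hε t htU
    calc κβ t * (q : ℂ) ^ (oβ t) * W t = (ε t * ε t) * (κβ t * (q : ℂ) ^ (oβ t) * W t) := by rw [hεε, one_mul]
      _ = _ := by field_simp

end OfShellWindow

end Literature.NumberTheory.Rogawski1990
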